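import Summits.ValiantsHypothesis.ValiantsHypothesis.Theorems.MonotoneRestorationOrbitRestorationQPDerivativeTowerWaringAlt
import HarnessLib

/-!
# Polynomial catalecticant rank ⇒ orbit-restorable, modulo the small-modules alt-spanning property

Route MonotoneRestoration, crux `OrbitRestorationQP` (stmt-ValiantsHypothesis-18293), line `depth-three-rung`,
stub A_∞ `stub_sigmaPiSigmaValue`.  Namespace `Summit.ValiantsHypothesis.ValiantsHypothesis.Theorems.DerivativeTower`.

`…DerivativeTowerWaringAlt.lean` used the Waring shape of `f` only through two consequences: every level of the
derivative chain `derivChain f m` (span of the order-`m` partial derivatives) is finite-dimensional of dimension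
`≤ r`, and consists of homogeneous polynomials.  This file records the general statement — the natural home of
the mechanism is the class of homogeneous polynomials of POLYNOMIAL CATALECTICANT RANK (all derivative spaces
of dimension `≤ r`), which contains ΣΛΣ and, e.g., sums of products of few high powers:

* `isHomogeneous_of_mem_derivChain_of_isHomogeneous` — the chain of a homogeneous `f` of degree `d` lives in
  degree `d − m` (Mathlib `IsHomogeneous.pderiv`);
* `qpOrbitRestorable_of_smallDerivChain` — **if every level of `derivChain f` has dimension `≤ r`, `f` is
  homogeneous and matrix-symmetric, and the alt-spanning property `hKey` holds for matrix-stable subspaces of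
  dimension `≤ r`, then `QPOrbitRestorable (k + 7) n f`.**

Honest label: conditional on the one representation-theoretic hypothesis `hKey`; A_∞ and the crux stay open;
VP ≠ VNP untouched. [folklore]
-/

noncomputable section

open scoped Classical

-- `Summit.ValiantsHypothesis.ValiantsHypothesis.…` is the tree's single-conjunct layout (Sub = Summit).
set_option linter.dupNamespace false

namespace Summit.ValiantsHypothesis.ValiantsHypothesis.Theorems

namespace DerivativeTower

open MvPolynomial Finset Equiv OrbitRestorationQPDepthThreeRung LevelStructure

variable {n : ℕ}

/-- The derivative chain of a homogeneous polynomial of degree `d` lives in degree `d − m`. [folklore] -/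
theorem isHomogeneous_of_mem_derivChain_of_isHomogeneous {f : MvPolynomial (Fin n × Fin n) ℂ} {d : ℕ}
    (hf : f.IsHomogeneous d) : ∀ (m : ℕ) {p : MvPolynomial (Fin n × Fin n) ℂ},
      p ∈ derivChain f m → p.IsHomogeneous (d - m)
  | 0, p, hp => by
      rw [derivChain, Submodule.mem_span_singleton] at hp
      obtain ⟨c, rfl⟩ := hp
      rw [Nat.sub_zero]
      exact (homogeneousSubmodule (Fin n × Fin n) ℂ d).smul_mem c hf
  | m + 1, p, hp => by
      have hle : derivChain f (m + 1) ≤ homogeneousSubmodule (Fin n × Fin n) ℂ (d - (m + 1)) := by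
        rw [derivChain, Submodule.span_le]
        rintro _ ⟨x, q, hq, rfl⟩
        rw [SetLike.mem_coe, mem_homogeneousSubmodule, show d - (m + 1) = d - m - 1 by omega]
        exact (isHomogeneous_of_mem_derivChain_of_isHomogeneous hf m hq).pderiv
      exact (mem_homogeneousSubmodule _ _).1 (hle hp)

/-- **POLYNOMIAL CATALECTICANT RANK ⇒ ORBIT-RESTORABLE (modulo the alt-spanning property).**  Let `f` be
homogeneous of degree `d`, invariant under independent row and column permutations, with every derivative
space `derivChain f m` finite-dimensional of dimension `≤ r`.  If every finite-dimensional matrix-stable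
subspace of dimension `≤ r` is spanned by its members fixed by all even permutations fixing `≤ k` indices
pointwise, then `f` is `QPOrbitRestorable (k + 7) n f`. [folklore] -/
theorem qpOrbitRestorable_of_smallDerivChain {k r d : ℕ}
    (hKey : ∀ W : Submodule ℂ (MvPolynomial (Fin n × Fin n) ℂ), FiniteDimensional ℂ W →
      Module.finrank ℂ W ≤ r → (∀ σ τ : Perm (Fin n), ∀ w ∈ W, mact σ τ w ∈ W) →
        W ≤ Submodule.span ℂ {v | v ∈ W ∧ ∃ Y : Finset (Fin n), Y.card ≤ k ∧
          ∀ ρ : Perm (Fin n), (∀ i ∈ Y, ρ i = i) → Perm.sign ρ = 1 → ren ρ v = v})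
    {f : MvPolynomial (Fin n × Fin n) ℂ} (hhom : f.IsHomogeneous d)
    (hrank : ∀ m, FiniteDimensional ℂ (derivChain f m) ∧ Module.finrank ℂ (derivChain f m) ≤ r)
    (hsym : ∀ σ τ : Perm (Fin n), mact σ τ f = f) :
    QPOrbitRestorable (k + 7) n f := by
  let Supp : ℕ → Set (MvPolynomial (Fin n × Fin n) ℂ) := fun m =>
    {v | v ∈ derivChain f m ∧ ∃ Y : Finset (Fin n), Y.card ≤ k ∧
      ∀ ρ : Perm (Fin n), (∀ i ∈ Y, ρ i = i) → Perm.sign ρ = 1 → ren ρ v = v}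
  have hspan : ∀ m, derivChain f m ≤ Submodule.span ℂ (Supp m) := fun m =>
    hKey _ (hrank m).1 (hrank m).2 (fun σ τ v hv => mact_mem_derivChain hsym σ τ m hv)
  have hfin : ∀ m, ∃ T : Finset (MvPolynomial (Fin n × Fin n) ℂ), (↑T : Set _) ⊆ Supp m ∧
      derivChain f m ≤ Submodule.span ℂ (T : Set _) := by
    intro m
    haveI := (hrank m).1
    obtain ⟨S₀, hS₀⟩ := (Submodule.fg_iff_finiteDimensional _).2 (hrank m).1
    have hch : ∀ s ∈ S₀, ∃ F : Finset (MvPolynomial (Fin n × Fin n) ℂ), (↑F : Set _) ⊆ Supp m ∧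
        s ∈ Submodule.span ℂ (F : Set _) := by
      intro s hs
      have hs' : s ∈ derivChain f m := by rw [← hS₀]; exact Submodule.subset_span hs
      exact Submodule.mem_span_finite_of_mem_span (hspan m hs')
    choose F hF using hch
    refine ⟨S₀.attach.biUnion fun s => F s.1 s.2, ?_, ?_⟩
    · intro v hv
      simp only [Finset.coe_biUnion, Finset.coe_attach, Set.mem_univ, Set.iUnion_true, Set.mem_iUnion] at hv
      obtain ⟨s, hv⟩ := hv
      exact (hF s.1 s.2).1 hv
    · rw [← hS₀, Submodule.span_le]
      intro s hs
      refine Submodule.span_mono ?_ (hF s hs).2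
      intro v hv
      simp only [Finset.coe_biUnion, Finset.coe_attach, Set.mem_univ, Set.iUnion_true, Set.mem_iUnion]
      exact ⟨⟨s, hs⟩, hv⟩
  choose T hT using hfin
  let T' : ℕ → Finset (MvPolynomial (Fin n × Fin n) ℂ) := fun m => if m = 0 then insert f (T 0) else T m
  have hT'sub : ∀ m, ∀ t ∈ T' m, t ∈ derivChain f m ∧ ∃ Y : Finset (Fin n), Y.card ≤ k ∧
      ∀ ρ : Perm (Fin n), (∀ i ∈ Y, ρ i = i) → Perm.sign ρ = 1 → ren ρ t = t := by
    intro m t ht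
    by_cases hm : m = 0
    · subst hm
      simp only [T', if_true, Finset.mem_insert] at ht
      rcases ht with rfl | ht
      · refine ⟨mem_derivChain_zero _, ∅, by simp, fun ρ _ _ => ?_⟩
        rw [ren_eq_mact]; exact hsym ρ ρ
      · exact (hT 0).1 ht
    · simp only [T', if_neg hm] at ht
      exact (hT m).1 ht
  have hT'span : ∀ m, derivChain f m ≤ Submodule.span ℂ (T' m : Set _) := by
    intro m
    refine (hT m).2.trans (Submodule.span_mono ?_)
    by_cases hm : m = 0
    · subst hm; simp only [T', if_true, Finset.coe_insert]; exact Set.subset_insert _ _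
    · simp only [T', if_neg hm]; exact le_rfl
  refine DerivativeTowerAlt.qpOrbitRestorable_of_altTower (d := d) T'
    (fun m t ht => isHomogeneous_of_mem_derivChain_of_isHomogeneous hhom m (hT'sub m t ht).1)
    (fun m t ht => (hT'sub m t ht).2)
    (fun m _ t ht x => hT'span (m + 1) (pderiv_mem_derivChain (hT'sub m t ht).1 x))
    (by simp [T']) fun σ => ?_
  rw [ren_eq_mact]; exact hsym σ σ

end DerivativeTower

end Summit.ValiantsHypothesis.ValiantsHypothesis.Theorems

end
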